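import Summits.NavierStokesRegularity.NavierStokesRegularity.Theorems.CertifiedBlowupCertifiedBlowupAxisymBlowupKatoLifespan
import Literature.Analysis.FluidPDE.MildSolutionsProofs
import Literature.Analysis.FunctionSpaces.FourierSobolevNormProofs
import HarnessLib

/-!
# Every witness of the crux `CertifiedBlowupAxisymBlowup` lies at or above the Rusin–Šverák
# threshold `ρ_max(ν)` in `Ḣ^{1/2}`

Theorems file landed `--supports stmt-NavierStokesRegularity-0727`, line `compact-amplification`
(continuation lead c4, wave S7; registered stub `rusinSverakRhoMax_le_of_isMaximalSmoothSolution`).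
A witness of the crux is a viscosity `ν > 0`, a time `T > 0` and a maximal smooth solution `(u, p)`
of the unforced Navier–Stokes system of finite lifespan `T`, Leray–Hopf on `[0, T]` from its rapidly
decaying axisymmetric datum `u 0`. Rusin–Šverák 2011, §1: `ρ_max` is the supremum of the radii
`ρ` such that every divergence-free datum of the open `Ḣ^{1/2}`-ball `B_ρ` has a global regular
(Fujita–Kato) solution; the tree's `rusinSverakRhoMax ν` is its finite-energy (`Ḣ^{1/2} ∩ L²`)
transcription (`MildSolutions.lean`). At the crux: the datum of every witness has
`‖u(0)‖_{Ḣ^{1/2}} ≥ ρ_max(ν)` — the critical-norm twin of the swirl threshold of route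
SwirlThreshold. Proof: the datum is Schwartz (smooth + `HasRapidSpatialDecay`), hence in
`Ḣ^{1/2} ∩ L²` (Mathlib `SchwartzMap.memSobolev` + the tree bridges
`memSobolev_two_iff_eFourierSobolevNorm_lt_top_holds`, `MemFourierSobolev.memHomSobolev_holds`),
and weakly divergence free (`VectorCalculus.IsDivFree.isWeaklyDivFree_holds`); were
`‖u(0)‖_{Ḣ^{1/2}} < ρ_max(ν)`, the datum would have a global Fujita–Kato solution
(`hasGlobalFujitaKatoSolution_of_lt_rusinSverakRhoMax`), which is a global Kato solution by the
critical embedding `C([0,∞); Ḣ^{1/2} ∩ L²) ⊂ C([0,∞); L³)`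
(`ContinuousInHomSobolevOn.continuousInLpOn_three`), so `katoMaximalTime ν (u 0) = ⊤`
(`HasGlobalKatoSolution.katoMaximalTime_eq_top`) — contradicting the landed identification of the
lifespan with Kato's maximal time, `katoMaximalTime_eq_of_isMaximalSmoothSolution` (`= ofReal T`).

No new definitions, no named-fact hypotheses, no `sorry`.

## References

* W. Rusin, V. Šverák, *Minimal initial data for potential Navier–Stokes singularities*,
  J. Funct. Anal. 260 (2011) 879–891 = arXiv:0911.0500, §1 (definition of `ρ_max`). [RusinSverak2011]
* H. Fujita, T. Kato, *On the Navier–Stokes initial value problem. I*, Arch. Rational Mech. Anal. 16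
  (1964) 269–315, Thm. 1.2. [FujitaKato1964ARMA]
* P. G. Lemarié-Rieusset, *The Navier–Stokes Problem in the 21st Century*, CRC 2016, §7.2 (Sobolev
  embedding `Ḣ^{1/2} ⊂ L³`), Thm. 7.4, Thm. 15.1. [LemarieRieusset2016]
-/

-- the summit and its single problem share the name (D-0017 nested layout)
set_option linter.dupNamespace false

noncomputable section

open MeasureTheory Set Function Filter Topology Metric
open scoped ENNReal NNReal SchwartzMap ContDiff

namespace Summit.NavierStokesRegularity.NavierStokesRegularity.Theorems.CertifiedBlowupAxisymBlowup.CompactAmplification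

open Literature.Analysis Literature.Analysis.FluidPDE
open Literature.Analysis.FunctionSpaces (MemHomSobolev MemFourierSobolev
  memSobolev_two_iff_eFourierSobolevNorm_lt_top_holds)
open Literature.Analysis.FunctionSpaces.EuclideanSpace (complexify contDiff_complexify_comp_iff)

/-- **Schwartz maps lie in `Ḣ^s ∩ L²` for `s ≥ 0`.** Mathlib's `SchwartzMap.memSobolev` puts the
tempered distribution of `f` in the Bessel-potential class `MemSobolev s 2`; by
`Lp.toTemperedDistribution_toLp_eq` this is the distribution of the `L²` class `f.toLp 2`, so the
bridge `memSobolev_two_iff_eFourierSobolevNorm_lt_top_holds` gives `‖f‖_{H^s} < ∞`, i.e.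
`MemFourierSobolev s ⇑f`, and `H^s ⊆ Ḣ^s ∩ L²` for `s ≥ 0` (`MemFourierSobolev.memHomSobolev_holds`;
Bahouri–Chemin–Danchin 2011, §1.4.1). (Same argument as the private
`thresholdFinite_memHomSobolev_schwartz` of `Theorems/AxisymmetricExtremalityMinimalDatumPFoldThresholdFinite.lean`.)
[folklore] -/
private theorem memHomSobolev_schwartz {E F : Type*} [NormedAddCommGroup E]
    [InnerProductSpace ℝ E] [FiniteDimensional ℝ E] [MeasurableSpace E] [BorelSpace E]
    [NormedAddCommGroup F] [InnerProductSpace ℂ F] [CompleteSpace F] {s : ℝ} (hs : 0 ≤ s)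
    (f : 𝓢(E, F)) : MemHomSobolev s (⇑f) := by
  have hB : TemperedDistribution.MemSobolev s 2
      ((f.toLp 2 (volume : Measure E) : Lp F 2 (volume : Measure E)) : 𝓢'(E, F)) := by
    rw [Lp.toTemperedDistribution_toLp_eq]
    exact f.memSobolev
  have h := memSobolev_two_iff_eFourierSobolevNorm_lt_top_holds (E := E) (F := F)
  exact FunctionSpaces.MemFourierSobolev.memHomSobolev_holds hs ⟨f.memLp 2 volume, (h s _).1 hB⟩

/-- **A smooth rapidly decaying field on `ℝ³` has complexification in `Ḣ^{1/2} ∩ L²`**: the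
bounds `HasRapidSpatialDecay` together with `ContDiff ℝ ∞` are exactly the Schwartz seminorm
bounds, `complexify` is an `ℝ`-linear isometry (so it preserves the norms of all iterated
derivatives, `LinearIsometry.norm_iteratedFDeriv_comp_left`), and Schwartz maps lie in
`Ḣ^{1/2} ∩ L²` (`memHomSobolev_schwartz`). [folklore] -/
private theorem memHomSobolev_half_complexify_of_hasRapidSpatialDecay
    {v : EuclideanSpace ℝ (Fin 3) → EuclideanSpace ℝ (Fin 3)} (hsm : ContDiff ℝ ∞ v)
    (hdec : HasRapidSpatialDecay v) :
    MemHomSobolev (1 / 2 : ℝ) (complexify ∘ v) := by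
  have hdecay : ∀ k n : ℕ, ∃ C : ℝ, ∀ x : EuclideanSpace ℝ (Fin 3),
      ‖x‖ ^ k * ‖iteratedFDeriv ℝ n (complexify ∘ v) x‖ ≤ C := by
    intro k n
    obtain ⟨C, hC⟩ := hdec n k
    refine ⟨C, fun x => le_trans ?_ (hC x)⟩
    rw [(complexify (ι := Fin 3)).norm_iteratedFDeriv_comp_left hsm.contDiffAt
      (mod_cast le_top)]
    exact mul_le_mul_of_nonneg_right
      (pow_le_pow_left₀ (norm_nonneg _) (le_add_of_nonneg_left zero_le_one) k) (norm_nonneg _)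
  exact memHomSobolev_schwartz (by norm_num)
    ⟨complexify ∘ v, contDiff_complexify_comp_iff.2 hsm, hdecay⟩

/-- **A global Fujita–Kato solution is a global Kato solution** (the easy direction of "the Kato
and the Fujita–Kato solutions coincide", Rusin–Šverák 2011, §1): a global mild solution in
`C([0,∞); Ḣ^{1/2} ∩ L²)` is in `C([0,∞); L³)` by the critical Sobolev embedding
`Ḣ^{1/2}(ℝ³) ⊂ L³(ℝ³)` (`ContinuousInHomSobolevOn.continuousInLpOn_three`; Lemarié-Rieusset 2016,
§7.2, proof of Lemma 7.3). [cite: LemarieRieusset2016, §7.2 Lemma 7.3 (proof, Sobolev embedding) and §7.4 Thm. 7.4] -/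
theorem hasGlobalKatoSolution_of_hasGlobalFujitaKatoSolution {ν : ℝ}
    {u₀ : EuclideanSpace ℝ (Fin 3) → EuclideanSpace ℝ (Fin 3)}
    (h : HasGlobalFujitaKatoSolution ν u₀) : HasGlobalKatoSolution ν u₀ := by
  obtain ⟨v, hv, hvH, -, hv0, hvm⟩ := h
  exact ⟨v, hv, hvH.continuousInLpOn_three, hv0, hvm⟩

/-- **Every witness of the crux lies at or above the Rusin–Šverák threshold** (registered stub of
stmt-NavierStokesRegularity-0727, wave S7; Rusin–Šverák 2011, §1, definition of `ρ_max`): for a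
maximal smooth solution `(u, p)` of viscosity `ν > 0` and finite lifespan `T > 0`, Leray–Hopf on
`[0, T]` from its rapidly decaying axisymmetric datum `u 0`,
`rusinSverakRhoMax ν ≤ ‖u 0‖_{Ḣ^{1/2}}` (the `Ḣ^{1/2} ∩ L²` seminorm of `complexify ∘ u 0`).
Otherwise the datum — Schwartz, hence in `Ḣ^{1/2} ∩ L²`
(`memHomSobolev_half_complexify_of_hasRapidSpatialDecay`), and weakly divergence free
(`VectorCalculus.IsDivFree.isWeaklyDivFree_holds`) — lies in the open ball `B_{ρ_max}` and so has
a global Fujita–Kato solution (`hasGlobalFujitaKatoSolution_of_lt_rusinSverakRhoMax`), hence a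
global Kato solution (`hasGlobalKatoSolution_of_hasGlobalFujitaKatoSolution`), hence
`katoMaximalTime ν (u 0) = ⊤` (`HasGlobalKatoSolution.katoMaximalTime_eq_top`), contradicting
`katoMaximalTime ν (u 0) = ofReal T` (`katoMaximalTime_eq_of_isMaximalSmoothSolution`). The
axisymmetry hypothesis is not used.
[cite: RusinSverak2011, §1 (definition of ρ_max), arXiv:0911.0500] -/
theorem rusinSverakRhoMax_le_of_isMaximalSmoothSolution : ∀ {ν T : ℝ} {u : ℝ → EuclideanSpace ℝ (Fin 3) → EuclideanSpace ℝ (Fin 3)} {p : ℝ → EuclideanSpace ℝ (Fin 3) → ℝ}, 0 < ν → 0 < T → IsMaximalSmoothSolution ν 0 u p T → IsLerayHopfOn T ν 0 (u 0) u → HasRapidSpatialDecay (u 0) → IsAxisymmetric (u 0) → rusinSverakRhoMax ν ≤ Function.eHomSobolevSeminorm (1 / 2 : ℝ) (FunctionSpaces.EuclideanSpace.complexify ∘ u 0) := by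
  intro ν T u p hν hT hmax hLH hdec _hax
  refine not_lt.1 fun hlt => ?_
  have h0T : (0 : ℝ) ∈ Ico 0 T := ⟨le_rfl, hT⟩
  have hsm : ContDiff ℝ ∞ (u 0) := hmax.1.contDiff_velocity h0T
  have hdiv : VectorCalculus.IsDivFree (u 0) := hmax.1.divFree 0 h0T
  -- the datum is in `Ḣ^{1/2} ∩ L²` and weakly divergence free
  have hmem : MemHomSobolev (1 / 2 : ℝ) (complexify ∘ u 0) :=
    memHomSobolev_half_complexify_of_hasRapidSpatialDecay hsm hdec
  have hwdiv : IsWeaklyDivFree (u 0) :=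
    VectorCalculus.IsDivFree.isWeaklyDivFree_holds hdiv (hsm.of_le (mod_cast le_top))
  -- below the threshold: a global Fujita–Kato solution, hence a global Kato solution
  have hK : HasGlobalKatoSolution ν (u 0) :=
    hasGlobalKatoSolution_of_hasGlobalFujitaKatoSolution
      (hasGlobalFujitaKatoSolution_of_lt_rusinSverakRhoMax hmem hwdiv hlt)
  -- so Kato's maximal time is infinite, contradicting its identification with the lifespan `T`
  have htop : katoMaximalTime ν (u 0) = ⊤ := hK.katoMaximalTime_eq_top
  rw [katoMaximalTime_eq_of_isMaximalSmoothSolution hν hT hmax hLH hdec] at htop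
  exact ENNReal.ofReal_ne_top htop

end Summit.NavierStokesRegularity.NavierStokesRegularity.Theorems.CertifiedBlowupAxisymBlowup.CompactAmplification

end
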